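import Summits.Ventures.YMGap.RobustBall.KernelClustering
import Summits.Ventures.YMGap.RobustBall.WilsonLoopBoundaryDecay
import Literature.MathematicalPhysics.QuantumFieldTheory.Sweep1ShenZhuZhuProofs
import HarnessLib

/-!
# Venture YMGap, track ROBUST-BALL — FINITE-VOLUME CLUSTERING UNIFORM IN THE VOLUME AND THE BOUNDARY FIELD,
# step 2: the tier-1 `ℤ^d` carrier, the ball, `SU(2)` hypothesis-free, the Wilson point, every `N`

HONEST FRAMING. WHAT THIS IS: a venture file (cell `pub-ymgap`, track Y2 ROBUST-BALL, seat ds-3, theorems only): the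
CARRIER half of the object «C-KMIX». The clustering rows of the tree (`MassGapOfDoor.perturbed_covariance_decay_of_
isKRContraction`, `UniformMassGapKR`, the `MassGapAt` / `PerturbedClustering` currencies) bound covariances under the
infinite-volume DLR STATES `μ`. Here the state is the FINITE-VOLUME GIBBS DISTRIBUTION `γ^W_Λ(· | η)` of the member
itself — the object lattice practice simulates — for an ARBITRARY finite link volume `Λ` (any shape) and an ARBITRARY
boundary field `η`, and the bound is the same, UNIFORMLY in `(Λ, η)`:

* CARRIER (`kernel_covariance_decay_of_isKRContraction`): given ANY `IsKRContraction (perturbedYM (fundamentalRep (Fin N))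
  (N β) W supp) suFrobDist (perturbedNbr supp) C` with row sums `≤ ρ < 1` and a member of `ℓ^∞`-range `R` (exactly the
  hypotheses of the infinite-volume row), for every `Λ`, `η` and Lipschitz cylinders `F₁` (links `Λ₁`, constant `K₁`),
  `F₂` (links `Λ₂`, constant `K₂`):
  `|cov_{γ^W_Λ(·|η)}(F₁, F₂)| ≤ 2(2√N)² · #Λ₁ · #Λ₂ · K₁K₂ · e^{κ} · e^{−(κ/max(1,R)) d(Λ₁,Λ₂)}`, `κ = −log max(ρ, ½)` —
  the generic kernel estimate `KernelClustering.abs_covariance_kernel_le` with the tree's link-distance profile;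
* THE BALL (`kernel_covariance_decay_of_pair`): uniformly on `MemBallZd ε₀ ε₁ R` through rb-p1's pair door;
  `SU(2)` HYPOTHESIS-FREE every `d` / `d = 4` (`su2_kernel_covariance_decay[_dim4]`); EVERY `N ≥ 2` through the
  Bakry–Émery pair (`suN_kernel_covariance_decay_bakryEmery`);
* THE WILSON POINT (`su2_wilson_kernel_clustering_upTo_oneTwelfth`): `SU(2)` lattice Yang–Mills on `ℤ⁴`, `0 ≤ β_W ≤ 1/12`:
  for EVERY finite link volume `Λ`, EVERY boundary field `η`:
  `|cov_{γ_Λ(·|η)}(F₁, F₂)| ≤ 32 · #Λ₁ · #Λ₂ · K₁K₂ · 2^{−d(Λ₁,Λ₂)}` (rate `log 2` per lattice unit); `1/12 ≤ β_W < 1/6`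
  with ratio `6β_W` (`_lt_oneSixth`); the plaquette–plaquette cell (`su2_wilson_kernel_plaquette_clustering_upTo_oneTwelfth`).
This is the covariance («strong mixing for all shapes») half of Dobrushin–Shlosman's finite-volume mixing conditions (J. Stat.
Phys. 46 (1987) 983–1014), in the cell's Kantorovich / Lipschitz-observable currency, for the whole tier-1 ball.
WHAT THIS IS NOT: not the total-variation form, not a log-Sobolev / spectral-gap statement for a dynamics, not complete
analyticity in full; the rate is the doors' Dobrushin-comparison LOWER bound (vanishing linearly at each door's
threshold, divided by the range); lattice strong coupling only — nothing about the continuum limit or the Clay problem.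
References: H. Föllmer, LNM 1362 (1988) Ch. I, Thm. (2.13) with (2.10); H. Shen, R. Zhu, X. Zhu, CMP 400 (2023), Cor. 1.6;
the tree's `KernelClustering.lean`, `MassGapOfDoor.lean`, `BoundaryDecayBall.lean`, `WilsonLoopBoundaryDecay.lean`.
-/

noncomputable section
open MeasureTheory Filter Function ProbabilityTheory Real
open scoped NNReal
open Literature.Probability.LatticeModels
open Literature.Probability.LatticeModels.DobrushinMetric
open Literature.MathematicalPhysics.QuantumLattice
open Literature.MathematicalPhysics.QuantumFieldTheory hiding ZdEdge Site
open Literature.MathematicalPhysics.QuantumFieldTheory (walkEdges card_walkEdges_le_length)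
open Summit.QuantumFields.BalabanUV.InfraRed.StrongCouplingPoincareDoorSUN (oneLinkPoincareSUN_two_sharp
  oneLinkPoincareSUN_bakryEmery)
open Summit.QuantumFields.BalabanUV.InfraRed.StrongCouplingVarianceDoorSUN (oneLinkVarianceBound_bakryEmery)

namespace Summit.Ventures.YMGap.RobustBall

variable {d N : ℕ}

/-- **FINITE-VOLUME CLUSTERING UNIFORM IN THE VOLUME AND THE BOUNDARY FIELD, from ANY robust single-link door.** Let
`IsKRContraction (perturbedYM (fundamentalRep (Fin N)) (N β) W supp) suFrobDist (perturbedNbr supp) C` have row sums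
`≤ ρ < 1` and let the member have `ℓ^∞`-range `R`. Then for EVERY finite link volume `Λ`, EVERY boundary field `η`
and all Lipschitz cylinders `F₁` (links `Λ₁`, constant `K₁`), `F₂` (links `Λ₂`, constant `K₂`):
`|cov_{γ^W_Λ(·|η)}(F₁, F₂)| ≤ 2(2√N)² #Λ₁ #Λ₂ K₁ K₂ e^{κ} e^{−(κ/max(1,R)) d(Λ₁,Λ₂)}`, `κ = −log max(ρ,½)` — the
same rate and constant as the DLR-state row `perturbed_covariance_decay_of_isKRContraction`, by
`KernelClustering.abs_covariance_kernel_le` with the profile `⌊dist(·, Λ₂)/max(1,R)⌋₊`. [folklore] -/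
theorem kernel_covariance_decay_of_isKRContraction {β ρ R : ℝ}
    {W : Potential (ZdEdge d) (Matrix.specialUnitaryGroup (Fin N) ℂ)} (hW : W.IsAdapted)
    (hWb : ∀ X, ∃ C, ∀ U, |W X U| ≤ C)
    {supp : Finset (ZdEdge d) → Finset (Finset (ZdEdge d))} (hsupp : W.IsSupportedBy supp)
    {C : ZdEdge d → ZdEdge d → ℝ}
    (hKR : IsKRContraction (perturbedYM (d := d) (fundamentalRep (Fin N)) (N * β) W supp) suFrobDist
      (perturbedNbr supp) C)
    (hrow : ∀ x, ∑ y ∈ perturbedNbr supp x, C x y ≤ ρ) (hρ : ρ < 1)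
    (hR : ∀ e, ∀ X ∈ supp {e}, e ∈ X → ∀ y ∈ X, ‖e.1 - y.1‖ ≤ R)
    (Λ : Finset (ZdEdge d)) (η : LGConfig d (Matrix.specialUnitaryGroup (Fin N) ℂ))
    {F₁ F₂ : LGConfig d (Matrix.specialUnitaryGroup (Fin N) ℂ) → ℝ} {Λ₁ Λ₂ : Finset (ZdEdge d)} {K₁ K₂ : ℝ≥0}
    (hF₁ : IsLipschitzCylinder (fundamentalRep (Fin N)) F₁ Λ₁ K₁)
    (hF₂ : IsLipschitzCylinder (fundamentalRep (Fin N)) F₂ Λ₂ K₂) :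
    |cov[F₁, F₂; perturbedYM (d := d) (fundamentalRep (Fin N)) (N * β) W supp Λ η]| ≤
      2 * (2 * Real.sqrt N) ^ 2 * Λ₁.card * Λ₂.card * ((K₁ : ℝ) * K₂) *
        (exp (-Real.log (max ρ (1 / 2))) * exp (-(-Real.log (max ρ (1 / 2)) / max 1 R) * setDistEdges Λ₁ Λ₂)) := by
  classical
  haveI : SecondCountableTopology (Matrix (Fin N) (Fin N) ℂ) :=
    inferInstanceAs (SecondCountableTopology (Fin N → Fin N → ℂ))
  haveI : SecondCountableTopology (Matrix.specialUnitaryGroup (Fin N) ℂ) :=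
    Topology.IsEmbedding.subtypeVal.secondCountableTopology
  have hγ : IsSpecification (perturbedYM (d := d) (fundamentalRep (Fin N)) (N * β) W supp) :=
    isSpecification_perturbedYM _ (continuous_fundamentalRep (Fin N)) _ hW hWb hsupp
  set c' : ℝ := max ρ (1 / 2) with hc'
  have hc'0 : 0 < c' := lt_max_of_lt_right (by norm_num)
  have hc'1 : c' < 1 := max_lt hρ (by norm_num)
  have hrow' : ∀ x ∈ Λ, ∑ y ∈ perturbedNbr supp x, C x y ≤ c' := fun x _ => (hrow x).trans (le_max_left _ _)
  set κ : ℝ := -Real.log c' with hκ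
  have hκ0 : 0 < κ := neg_pos.2 (Real.log_neg hc'0 hc'1)
  set R₀ : ℝ := max 1 R with hR₀
  have hR₀1 : 1 ≤ R₀ := le_max_left _ _
  have hR₀0 : 0 < R₀ := zero_lt_one.trans_le hR₀1
  have hRsqrt : (0 : ℝ) ≤ 2 * Real.sqrt N := by positivity
  have hnbr : ∀ x, ∀ y ∈ perturbedNbr supp x, ‖x.1 - y.1‖ ≤ R₀ := by
    intro x y hy
    rcases (mem_perturbedNbr_iff.1 hy).2 with hy' | ⟨X, hX, hxX, hyX⟩
    · exact (norm_sub_le_one_of_mem_linkPlaqNbr hy').trans hR₀1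
    · exact (hR x X hX hxX y hyX).trans (le_max_right _ _)
  set ℓ : ZdEdge d → ℕ := fun y => ⌊linkSetDist Λ₂ y / R₀⌋₊ with hℓ
  have hℓ0 : ∀ y ∈ Λ₂, ℓ y = 0 := fun y hy => by simp [hℓ, linkSetDist_eq_zero_of_mem hy]
  have hℓ1 : ∀ x ∉ Λ₂, ∀ y ∈ perturbedNbr supp x, ℓ x ≤ ℓ y + 1 := fun x _ y hy => by
    have h1 : linkSetDist Λ₂ x / R₀ ≤ linkSetDist Λ₂ y / R₀ + 1 := by
      rw [div_add_one hR₀0.ne', div_le_div_iff_of_pos_right hR₀0]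
      exact (linkSetDist_le_add_norm Λ₂ x y).trans (add_le_add_right (hnbr x y hy) _)
    calc ℓ x ≤ ⌊linkSetDist Λ₂ y / R₀ + 1⌋₊ := Nat.floor_mono h1
      _ = ℓ y + 1 := Nat.floor_add_one (div_nonneg (linkSetDist_nonneg _ _) hR₀0.le)
  have key := KernelClustering.abs_covariance_kernel_le hγ hKR (fun _ _ => suFrobDist_nonneg _ _)
    suFrobDist_le hRsqrt hc'0.le hc'1 Λ hrow' η
    hF₁.measurable hF₁.dependsOn hF₁.abs_le
    (hF₁.isLipBound zero_le_one (fun a b => by rw [one_mul]; exact dist_suEntries_le_suFrobDist a b))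
    hF₂.measurable hF₂.dependsOn hF₂.abs_le
    (hF₂.isLipBound zero_le_one (fun a b => by rw [one_mul]; exact dist_suEntries_le_suFrobDist a b))
    ℓ hℓ0 hℓ1
  have hK₁ : (0 : ℝ) ≤ K₁ := K₁.2
  have hK₂ : (0 : ℝ) ≤ K₂ := K₂.2
  have hsum₂ : ∑ y ∈ Λ₂, (if y ∈ Λ₂ then 1 * (K₂ : ℝ) else 0) = Λ₂.card * K₂ := by
    rw [Finset.sum_ite_of_true (fun y hy => hy), Finset.sum_const, nsmul_eq_mul, one_mul]
  have hm : ∀ y ∈ Λ₁, ⌊setDistEdges Λ₁ Λ₂ / R₀⌋₊ ≤ ℓ y := fun y hy =>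
    Nat.floor_mono (div_le_div_of_nonneg_right (setDistEdges_le_linkSetDist hy) hR₀0.le)
  have hsum₁ : ∑ y ∈ Λ₁, c' ^ ℓ y * (if y ∈ Λ₁ then 1 * (K₁ : ℝ) else 0) ≤
      Λ₁.card * (c' ^ ⌊setDistEdges Λ₁ Λ₂ / R₀⌋₊ * K₁) := by
    calc ∑ y ∈ Λ₁, c' ^ ℓ y * (if y ∈ Λ₁ then 1 * (K₁ : ℝ) else 0)
        ≤ ∑ y ∈ Λ₁, c' ^ ⌊setDistEdges Λ₁ Λ₂ / R₀⌋₊ * K₁ := Finset.sum_le_sum fun y hy => by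
          rw [if_pos hy, one_mul]
          exact mul_le_mul_of_nonneg_right (pow_le_pow_of_le_one hc'0.le hc'1.le (hm y hy)) hK₁
      _ = Λ₁.card * (c' ^ ⌊setDistEdges Λ₁ Λ₂ / R₀⌋₊ * K₁) := by rw [Finset.sum_const, nsmul_eq_mul]
  have hgeom : c' ^ ⌊setDistEdges Λ₁ Λ₂ / R₀⌋₊ ≤ exp κ * exp (-(κ / R₀) * setDistEdges Λ₁ Λ₂) := by
    have hfl : setDistEdges Λ₁ Λ₂ / R₀ - 1 ≤ (⌊setDistEdges Λ₁ Λ₂ / R₀⌋₊ : ℝ) := by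
      have := Nat.lt_floor_add_one (setDistEdges Λ₁ Λ₂ / R₀)
      linarith
    rw [← exp_add, ← Real.rpow_natCast, Real.rpow_def_of_pos hc'0]
    refine exp_le_exp.2 ?_
    have hlog : Real.log c' = -κ := by rw [hκ, neg_neg]
    rw [hlog]
    have := mul_le_mul_of_nonneg_left hfl hκ0.le
    have e1 : -(κ / R₀) * setDistEdges Λ₁ Λ₂ = -(κ * (setDistEdges Λ₁ Λ₂ / R₀)) := by
      field_simp
    rw [e1]
    linarith
  calc |cov[F₁, F₂; perturbedYM (d := d) (fundamentalRep (Fin N)) (N * β) W supp Λ η]|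
      ≤ 2 * (2 * Real.sqrt N) ^ 2 * (∑ y ∈ Λ₂, (if y ∈ Λ₂ then 1 * (K₂ : ℝ) else 0)) *
          ∑ y ∈ Λ₁, c' ^ ℓ y * (if y ∈ Λ₁ then 1 * (K₁ : ℝ) else 0) := key
    _ ≤ 2 * (2 * Real.sqrt N) ^ 2 * (Λ₂.card * K₂) * (Λ₁.card * (c' ^ ⌊setDistEdges Λ₁ Λ₂ / R₀⌋₊ * K₁)) := by
        rw [hsum₂]
        exact mul_le_mul_of_nonneg_left hsum₁ (by positivity)
    _ ≤ 2 * (2 * Real.sqrt N) ^ 2 * (Λ₂.card * K₂) *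
          (Λ₁.card * (exp κ * exp (-(κ / R₀) * setDistEdges Λ₁ Λ₂) * K₁)) := by
        gcongr
    _ = 2 * (2 * Real.sqrt N) ^ 2 * Λ₁.card * Λ₂.card * ((K₁ : ℝ) * K₂) *
          (exp κ * exp (-(κ / R₀) * setDistEdges Λ₁ Λ₂)) := by ring

/-- **FINITE-VOLUME CLUSTERING UNIFORMLY ON THE TIER-1 BALL from a one-link pair.** For `d, N ≥ 1`, a 't Hooft
coupling `β`, a Poincaré/variance pair `(c, v)` of the unperturbed `SU(N)` one-link family on `‖B‖_op ≤ b`,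
`b ≥ 2(d−1)|β|`, and `6(d−1)|β| e^{ε₀} √(c v) + e^{ε₀/2} √c ε₁ ≤ ρ < 1`: for EVERY member `(W, supp)` of
`MemBallZd ε₀ ε₁ R`, every finite link volume `Λ`, every boundary field `η` and Lipschitz cylinders `F₁, F₂`:
`|cov_{γ^W_Λ(·|η)}(F₁, F₂)| ≤ 2(2√N)² #Λ₁ #Λ₂ K₁K₂ e^{κ} e^{−(κ/max(1,R)) d(Λ₁,Λ₂)}`, `κ = −log max(ρ,½)` — one rate and
one constant for the whole ball, all volumes and all boundary fields. [folklore] -/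
theorem kernel_covariance_decay_of_pair (hd : 1 ≤ d) (hN : 1 ≤ N) {β b c v ε₀ ε₁ ρ R : ℝ} (hc : 0 ≤ c)
    (hv : 0 ≤ v) (hb : |β| * (2 * ((d : ℝ) - 1)) ≤ b)
    (hP : ∀ B : Matrix (Fin N) (Fin N) ℂ, matrixOpNorm B ≤ b →
      ∀ (ψ : Matrix.specialUnitaryGroup (Fin N) ℂ → ℝ) (M : ℝ), 0 ≤ M →
        (∀ x y, |ψ x - ψ y| ≤ M * suFrobDist x y) →
        Var[ψ; (haarProbability (Matrix.specialUnitaryGroup (Fin N) ℂ)).tilted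
          fun g => (N : ℝ) * ((g : Matrix (Fin N) (Fin N) ℂ) * B).trace.re] ≤ c * M ^ 2)
    (hVB : ∀ B : Matrix (Fin N) (Fin N) ℂ, matrixOpNorm B ≤ b → ∀ Δ : Matrix (Fin N) (Fin N) ℂ,
      Var[fun g : Matrix.specialUnitaryGroup (Fin N) ℂ =>
          (N : ℝ) * ((g : Matrix (Fin N) (Fin N) ℂ) * Δ).trace.re;
        (haarProbability (Matrix.specialUnitaryGroup (Fin N) ℂ)).tilted
          fun g => (N : ℝ) * ((g : Matrix (Fin N) (Fin N) ℂ) * B).trace.re] ≤ v * frobNorm Δ ^ 2)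
    (hρ : 6 * ((d : ℝ) - 1) * |β| * (exp ε₀ * Real.sqrt (c * v)) + exp (ε₀ / 2) * Real.sqrt c * ε₁ ≤ ρ)
    (hρ1 : ρ < 1) {W : Potential (ZdEdge d) (Matrix.specialUnitaryGroup (Fin N) ℂ)}
    {supp : Finset (ZdEdge d) → Finset (Finset (ZdEdge d))} (hmem : MemBallZd ε₀ ε₁ R W supp)
    (Λ : Finset (ZdEdge d)) (η : LGConfig d (Matrix.specialUnitaryGroup (Fin N) ℂ))
    {F₁ F₂ : LGConfig d (Matrix.specialUnitaryGroup (Fin N) ℂ) → ℝ} {Λ₁ Λ₂ : Finset (ZdEdge d)} {K₁ K₂ : ℝ≥0}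
    (hF₁ : IsLipschitzCylinder (fundamentalRep (Fin N)) F₁ Λ₁ K₁)
    (hF₂ : IsLipschitzCylinder (fundamentalRep (Fin N)) F₂ Λ₂ K₂) :
    |cov[F₁, F₂; perturbedYM (d := d) (fundamentalRep (Fin N)) (N * β) W supp Λ η]| ≤
      2 * (2 * Real.sqrt N) ^ 2 * Λ₁.card * Λ₂.card * ((K₁ : ℝ) * K₂) *
        (exp (-Real.log (max ρ (1 / 2))) * exp (-(-Real.log (max ρ (1 / 2)) / max 1 R) * setDistEdges Λ₁ Λ₂)) := by
  haveI : SecondCountableTopology (Matrix (Fin N) (Fin N) ℂ) :=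
    inferInstanceAs (SecondCountableTopology (Fin N → Fin N → ℂ))
  haveI : SecondCountableTopology (Matrix.specialUnitaryGroup (Fin N) ℂ) :=
    Topology.IsEmbedding.subtypeVal.secondCountableTopology
  obtain ⟨osc, lip, hosc, hlip, hosca, hΛ⟩ := hmem.loads
  have hW : W.IsAdapted := fun X => ⟨hmem.dependsOn X, (hmem.continuous X).measurable⟩
  have hWb : ∀ X, ∃ C, ∀ U, |W X U| ≤ C := fun X => exists_bound_of_continuous (hmem.continuous X)
  have hKR := isKRContraction_perturbedYM_SU hd hN hc hv hb hP hVB hW (supp := supp) hosc hosca hlip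
  have hrow : ∀ x, ∑ y ∈ perturbedNbr supp x,
      (exp ε₀ * Real.sqrt (c * v) * |β| * linkInfluence x y +
        exp (ε₀ / 2) * Real.sqrt c * ∑ X ∈ (supp {x}).filter (fun X => x ∈ X), lip X y) ≤ ρ :=
    fun x => (sum_perturbedNbr_coeff_le hd (β := β) (c := c) (v := v) (a := ε₀) hΛ x).trans hρ
  exact kernel_covariance_decay_of_isKRContraction hW hWb hmem.supportedBy hKR hrow hρ1 hmem.range Λ η hF₁ hF₂

/-- **`SU(2)`, HYPOTHESIS-FREE, every `d ≥ 1`** (sharp one-link Poincaré constant `2/3`, `√(c v) = 4/3`; Wilson units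
`β = β_W/4`): if `2(d−1)|β_W| e^{ε₀} + e^{ε₀/2} √(2/3) ε₁ ≤ ρ < 1` then for every member of `MemBallZd ε₀ ε₁ R`, every
finite link volume `Λ`, every boundary field `η` and Lipschitz cylinders `F₁, F₂`:
`|cov_{γ^W_Λ(·|η)}(F₁, F₂)| ≤ 16 #Λ₁ #Λ₂ K₁K₂ e^{κ} e^{−(κ/max(1,R)) d(Λ₁,Λ₂)}`, `κ = −log max(ρ,½)`. [folklore] -/
theorem su2_kernel_covariance_decay (hd : 1 ≤ d) {βW ε₀ ε₁ ρ R : ℝ}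
    (hρ : 2 * ((d : ℝ) - 1) * |βW| * exp ε₀ + exp (ε₀ / 2) * Real.sqrt (2 / 3) * ε₁ ≤ ρ) (hρ1 : ρ < 1)
    {W : Potential (ZdEdge d) (Matrix.specialUnitaryGroup (Fin 2) ℂ)}
    {supp : Finset (ZdEdge d) → Finset (Finset (ZdEdge d))} (hmem : MemBallZd ε₀ ε₁ R W supp)
    (Λ : Finset (ZdEdge d)) (η : LGConfig d (Matrix.specialUnitaryGroup (Fin 2) ℂ))
    {F₁ F₂ : LGConfig d (Matrix.specialUnitaryGroup (Fin 2) ℂ) → ℝ} {Λ₁ Λ₂ : Finset (ZdEdge d)} {K₁ K₂ : ℝ≥0}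
    (hF₁ : IsLipschitzCylinder (fundamentalRep (Fin 2)) F₁ Λ₁ K₁)
    (hF₂ : IsLipschitzCylinder (fundamentalRep (Fin 2)) F₂ Λ₂ K₂) :
    |cov[F₁, F₂; perturbedYM (d := d) (fundamentalRep (Fin 2)) ((2 : ℕ) * (βW / 4)) W supp Λ η]| ≤
      16 * Λ₁.card * Λ₂.card * ((K₁ : ℝ) * K₂) *
        (exp (-Real.log (max ρ (1 / 2))) * exp (-(-Real.log (max ρ (1 / 2)) / max 1 R) * setDistEdges Λ₁ Λ₂)) := by
  have hc : (0 : ℝ) ≤ 2 / 3 := by norm_num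
  have hP : ∀ B : Matrix (Fin 2) (Fin 2) ℂ, matrixOpNorm B ≤ |βW / 4| * (2 * ((d : ℝ) - 1)) →
      ∀ (ψ : Matrix.specialUnitaryGroup (Fin 2) ℂ → ℝ) (M : ℝ), 0 ≤ M →
        (∀ x y, |ψ x - ψ y| ≤ M * suFrobDist x y) →
        Var[ψ; (haarProbability (Matrix.specialUnitaryGroup (Fin 2) ℂ)).tilted
          fun g => ((2 : ℕ) : ℝ) * ((g : Matrix (Fin 2) (Fin 2) ℂ) * B).trace.re] ≤ 2 / 3 * M ^ 2 :=
    fun B hB ψ M hM hψ => oneLinkPoincareSUN_two_sharp _ B hB ψ M hM hψ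
  have hVB := linVariance_of_poincare (N := 2) hP
  have hv : (0 : ℝ) ≤ 2 / 3 * ((2 : ℕ) : ℝ) ^ 2 := by norm_num
  have hsq : Real.sqrt (2 / 3 * (2 / 3 * ((2 : ℕ) : ℝ) ^ 2)) = 4 / 3 := by
    rw [show (2 / 3 * (2 / 3 * ((2 : ℕ) : ℝ) ^ 2) : ℝ) = (4 / 3) ^ 2 by norm_num, Real.sqrt_sq (by norm_num)]
  have hρ' : 6 * ((d : ℝ) - 1) * |βW / 4| * (exp ε₀ * Real.sqrt (2 / 3 * (2 / 3 * ((2 : ℕ) : ℝ) ^ 2))) +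
      exp (ε₀ / 2) * Real.sqrt (2 / 3) * ε₁ ≤ ρ := by
    rw [hsq]
    have e : 6 * ((d : ℝ) - 1) * |βW / 4| * (exp ε₀ * (4 / 3)) = 2 * ((d : ℝ) - 1) * |βW| * exp ε₀ := by
      rw [abs_div, abs_of_pos (by norm_num : (0 : ℝ) < 4)]
      ring
    rw [e]
    exact hρ
  have h := kernel_covariance_decay_of_pair hd (by norm_num) (R := R) hc hv le_rfl hP hVB hρ' hρ1 hmem Λ η hF₁ hF₂
  have e2 : (2 * (2 * Real.sqrt ((2 : ℕ) : ℝ)) ^ 2 : ℝ) = 16 := by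
    rw [mul_pow, Real.sq_sqrt (by norm_num)]; norm_num
  rw [e2] at h
  exact h

/-- **The `d = 4` reading for `SU(2)`**: `6|β_W| e^{ε₀} + e^{ε₀/2} √(2/3) ε₁ ≤ ρ < 1` ⇒ on the whole ball
`MemBallZd ε₀ ε₁ R` the finite-volume Gibbs distributions with ANY boundary field cluster exponentially on Lipschitz
cylinders: `|cov_{γ^W_Λ(·|η)}(F₁, F₂)| ≤ 16 #Λ₁ #Λ₂ K₁K₂ e^{κ} e^{−(κ/max(1,R)) d(Λ₁,Λ₂)}`. [folklore] -/
theorem su2_kernel_covariance_decay_dim4 {βW ε₀ ε₁ ρ R : ℝ}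
    (hρ : 6 * |βW| * exp ε₀ + exp (ε₀ / 2) * Real.sqrt (2 / 3) * ε₁ ≤ ρ) (hρ1 : ρ < 1)
    {W : Potential (ZdEdge 4) (Matrix.specialUnitaryGroup (Fin 2) ℂ)}
    {supp : Finset (ZdEdge 4) → Finset (Finset (ZdEdge 4))} (hmem : MemBallZd ε₀ ε₁ R W supp)
    (Λ : Finset (ZdEdge 4)) (η : LGConfig 4 (Matrix.specialUnitaryGroup (Fin 2) ℂ))
    {F₁ F₂ : LGConfig 4 (Matrix.specialUnitaryGroup (Fin 2) ℂ) → ℝ} {Λ₁ Λ₂ : Finset (ZdEdge 4)} {K₁ K₂ : ℝ≥0}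
    (hF₁ : IsLipschitzCylinder (fundamentalRep (Fin 2)) F₁ Λ₁ K₁)
    (hF₂ : IsLipschitzCylinder (fundamentalRep (Fin 2)) F₂ Λ₂ K₂) :
    |cov[F₁, F₂; perturbedYM (d := 4) (fundamentalRep (Fin 2)) ((2 : ℕ) * (βW / 4)) W supp Λ η]| ≤
      16 * Λ₁.card * Λ₂.card * ((K₁ : ℝ) * K₂) *
        (exp (-Real.log (max ρ (1 / 2))) * exp (-(-Real.log (max ρ (1 / 2)) / max 1 R) * setDistEdges Λ₁ Λ₂)) :=
  su2_kernel_covariance_decay (d := 4) (by norm_num) (by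
    have h6 : (2 : ℝ) * (((4 : ℕ) : ℝ) - 1) = 6 := by norm_num
    calc 2 * (((4 : ℕ) : ℝ) - 1) * |βW| * exp ε₀ + exp (ε₀ / 2) * Real.sqrt (2 / 3) * ε₁
        = 6 * |βW| * exp ε₀ + exp (ε₀ / 2) * Real.sqrt (2 / 3) * ε₁ := by rw [h6]
      _ ≤ ρ := hρ) hρ1 hmem Λ η hF₁ hF₂

/-! ### The Wilson point: finite-volume clustering of `SU(2)` lattice Yang–Mills on `ℤ⁴`, every volume, every boundary -/

/-- **THE WILSON POINT**: for `0 ≤ β_W ≤ 1/12`, EVERY finite-volume Wilson distribution `γ_Λ(· | η)` of `SU(2)` lattice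
Yang–Mills on `ℤ⁴` (tree coupling `β_W/2`) — ANY finite link volume `Λ`, ANY boundary field `η` — and all Lipschitz
cylinders `F₁` (links `Λ₁`, constant `K₁`), `F₂` (links `Λ₂`, constant `K₂`) satisfy
`|cov_{γ_Λ(·|η)}(F₁, F₂)| ≤ 32 · #Λ₁ · #Λ₂ · K₁K₂ · e^{−(log 2) d(Λ₁,Λ₂)}`: exponential clustering at rate `log 2` per
lattice unit, uniformly in the volume and the boundary field (row sum `6β_W ≤ 1/2`, the zero member). [folklore] -/
theorem su2_wilson_kernel_clustering_upTo_oneTwelfth {βW : ℝ} (h0 : 0 ≤ βW) (h : βW ≤ 1 / 12)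
    (Λ : Finset (ZdEdge 4)) (η : LGConfig 4 (Matrix.specialUnitaryGroup (Fin 2) ℂ))
    {F₁ F₂ : LGConfig 4 (Matrix.specialUnitaryGroup (Fin 2) ℂ) → ℝ} {Λ₁ Λ₂ : Finset (ZdEdge 4)} {K₁ K₂ : ℝ≥0}
    (hF₁ : IsLipschitzCylinder (fundamentalRep (Fin 2)) F₁ Λ₁ K₁)
    (hF₂ : IsLipschitzCylinder (fundamentalRep (Fin 2)) F₂ Λ₂ K₂) :
    |cov[F₁, F₂; ymSpecification (d := 4) (fundamentalRep (Fin 2)) (βW / 2) Λ η]| ≤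
      32 * Λ₁.card * Λ₂.card * ((K₁ : ℝ) * K₂) * exp (-Real.log 2 * setDistEdges Λ₁ Λ₂) := by
  have hβ : (((2 : ℕ) : ℝ) * (βW / 4) : ℝ) = βW / 2 := by push_cast; ring
  have hmem : MemBallZd (N := 2) (0 : ℝ) 0 0 (0 : Potential (ZdEdge 4) (Matrix.specialUnitaryGroup (Fin 2) ℂ))
      (fun _ => (∅ : Finset (Finset (ZdEdge 4)))) :=
    memBallZd_zero le_rfl le_rfl fun _ _ h => by simp at h
  have key := su2_kernel_covariance_decay_dim4 (ρ := 1 / 2) (ε₀ := 0) (ε₁ := 0) (by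
      rw [abs_of_nonneg h0, Real.exp_zero, zero_div, Real.exp_zero]
      linarith) (by norm_num) hmem Λ η hF₁ hF₂
  rw [perturbedYM_zero, hβ, max_self, max_eq_left (zero_le_one : (0 : ℝ) ≤ 1), div_one,
    Real.log_div (by norm_num) (by norm_num), Real.log_one, zero_sub, neg_neg, Real.exp_log (by norm_num)] at key
  refine key.trans (le_of_eq ?_)
  ring

/-- The same for `1/12 ≤ β_W < 1/6` with the geometric ratio `6β_W` (row sum `6β_W ≥ 1/2`):
`|cov_{γ_Λ(·|η)}(F₁, F₂)| ≤ (16/(6β_W)) · #Λ₁ · #Λ₂ · K₁K₂ · e^{−(−log(6β_W)) d(Λ₁,Λ₂)}` for every volume and boundary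
field. [folklore] -/
theorem su2_wilson_kernel_clustering_lt_oneSixth {βW : ℝ} (h0 : 1 / 12 ≤ βW) (h : βW < 1 / 6)
    (Λ : Finset (ZdEdge 4)) (η : LGConfig 4 (Matrix.specialUnitaryGroup (Fin 2) ℂ))
    {F₁ F₂ : LGConfig 4 (Matrix.specialUnitaryGroup (Fin 2) ℂ) → ℝ} {Λ₁ Λ₂ : Finset (ZdEdge 4)} {K₁ K₂ : ℝ≥0}
    (hF₁ : IsLipschitzCylinder (fundamentalRep (Fin 2)) F₁ Λ₁ K₁)
    (hF₂ : IsLipschitzCylinder (fundamentalRep (Fin 2)) F₂ Λ₂ K₂) :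
    |cov[F₁, F₂; ymSpecification (d := 4) (fundamentalRep (Fin 2)) (βW / 2) Λ η]| ≤
      16 * Λ₁.card * Λ₂.card * ((K₁ : ℝ) * K₂) *
        ((6 * βW)⁻¹ * exp (-(-Real.log (6 * βW)) * setDistEdges Λ₁ Λ₂)) := by
  have hβ : (((2 : ℕ) : ℝ) * (βW / 4) : ℝ) = βW / 2 := by push_cast; ring
  have hpos : 0 < 6 * βW := by linarith
  have hmem : MemBallZd (N := 2) (0 : ℝ) 0 0 (0 : Potential (ZdEdge 4) (Matrix.specialUnitaryGroup (Fin 2) ℂ))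
      (fun _ => (∅ : Finset (Finset (ZdEdge 4)))) :=
    memBallZd_zero le_rfl le_rfl fun _ _ h => by simp at h
  have key := su2_kernel_covariance_decay_dim4 (ρ := 6 * βW) (ε₀ := 0) (ε₁ := 0) (by
      rw [abs_of_nonneg (by linarith), Real.exp_zero, zero_div, Real.exp_zero]
      linarith) (by linarith) hmem Λ η hF₁ hF₂
  rw [perturbedYM_zero, hβ, max_eq_left (by linarith : (1 / 2 : ℝ) ≤ 6 * βW),
    max_eq_left (zero_le_one : (0 : ℝ) ≤ 1), div_one, Real.exp_neg, Real.exp_log hpos] at key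
  exact key

/-- **THE PLAQUETTE–PLAQUETTE CORRELATOR IN A FINITE VOLUME**: for `0 ≤ β_W ≤ 1/12`, every finite link volume `Λ` of
`ℤ⁴`, every boundary field `η`, and any two plaquettes `p = (x; i<j)`, `q = (y; k<l)` of `ℤ⁴`, the `SU(2)` plaquette
observables `W_p = ½ Re tr U_p` (tree `zdPlaquetteObs`, Lipschitz cylinders with constant `4·2³`) satisfy
`|cov_{γ_Λ(·|η)}(W_p, W_q)| ≤ 524288 · e^{−(log 2) d(p, q)}` — uniformly in `(Λ, η)`. [folklore] -/
theorem su2_wilson_kernel_plaquette_clustering_upTo_oneTwelfth {βW : ℝ} (h0 : 0 ≤ βW) (h : βW ≤ 1 / 12)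
    (Λ : Finset (ZdEdge 4)) (η : LGConfig 4 (Matrix.specialUnitaryGroup (Fin 2) ℂ))
    (x y : Site 4) {i j k l : Fin 4} (hij : i < j) (hkl : k < l) :
    |cov[zdPlaquetteObs (d := 4) (fundamentalRep (Fin 2)) x i j, zdPlaquetteObs (d := 4) (fundamentalRep (Fin 2)) y k l;
        ymSpecification (d := 4) (fundamentalRep (Fin 2)) (βW / 2) Λ η]| ≤
      524288 * exp (-Real.log 2 *
        setDistEdges (plaquetteEdges ((x, ⟨(i, j), hij⟩) : ZdPlaquette 4))
          (plaquetteEdges ((y, ⟨(k, l), hkl⟩) : ZdPlaquette 4))) := by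
  have h₁ := isLipschitzCylinder_zdPlaquetteObs (N := 2) x hij
  have h₂ := isLipschitzCylinder_zdPlaquetteObs (N := 2) y hkl
  have key := su2_wilson_kernel_clustering_upTo_oneTwelfth h0 h Λ η h₁ h₂
  have hc₁ : ((plaquetteEdges ((x, ⟨(i, j), hij⟩) : ZdPlaquette 4)).card : ℝ) ≤ 4 := by
    exact_mod_cast card_plaquetteEdges_le _
  have hc₂ : ((plaquetteEdges ((y, ⟨(k, l), hkl⟩) : ZdPlaquette 4)).card : ℝ) ≤ 4 := by
    exact_mod_cast card_plaquetteEdges_le _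
  have hK : (((4 * ((2 : ℕ) : ℝ≥0) ^ 3 : ℝ≥0)) : ℝ) = 32 := by push_cast; norm_num
  rw [hK] at key
  refine key.trans ?_
  set E := exp (-Real.log 2 * setDistEdges (plaquetteEdges ((x, ⟨(i, j), hij⟩) : ZdPlaquette 4))
    (plaquetteEdges ((y, ⟨(k, l), hkl⟩) : ZdPlaquette 4)))
  calc 32 * ((plaquetteEdges ((x, ⟨(i, j), hij⟩) : ZdPlaquette 4)).card : ℝ) *
        ((plaquetteEdges ((y, ⟨(k, l), hkl⟩) : ZdPlaquette 4)).card : ℝ) * ((32 : ℝ) * 32) * E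
      ≤ 32 * (4 : ℝ) * 4 * ((32 : ℝ) * 32) * E := by gcongr
    _ = 524288 * E := by norm_num

/-- **THE LOOP–LOOP (glueball) CORRELATOR IN A FINITE VOLUME**: for `0 ≤ β_W ≤ 1/12`, every finite link volume `Λ` of `ℤ⁴`,
every boundary field `η` and any two closed lattice walks `γ₁, γ₂`, the `SU(2)` Wilson-loop observables `W_γ = ½ Re tr U_γ` (tree
`loopTerm 2 1 γ`, Lipschitz cylinders with constant `√2|γ|` on `≤ |γ|` links) satisfy
`|cov_{γ_Λ(·|η)}(W_{γ₁}, W_{γ₂})| ≤ 64 · |γ₁|² · |γ₂|² · e^{−(log 2) d(γ₁, γ₂)}` — uniformly in `(Λ, η)`. [folklore] -/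
theorem su2_wilson_kernel_loop_clustering_upTo_oneTwelfth {βW : ℝ} (h0 : 0 ≤ βW) (h : βW ≤ 1 / 12)
    (Λ : Finset (ZdEdge 4)) (η : LGConfig 4 (Matrix.specialUnitaryGroup (Fin 2) ℂ))
    {x₁ x₂ : Literature.Probability.LatticeModels.Site 4} (w₁ : (zdGraph 4).Walk x₁ x₁) (w₂ : (zdGraph 4).Walk x₂ x₂) :
    |cov[loopTerm 2 1 w₁, loopTerm 2 1 w₂; ymSpecification (d := 4) (fundamentalRep (Fin 2)) (βW / 2) Λ η]| ≤
      64 * (w₁.length : ℝ) ^ 2 * (w₂.length : ℝ) ^ 2 * exp (-Real.log 2 * setDistEdges (walkEdges w₁) (walkEdges w₂)) := by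
  have key := su2_wilson_kernel_clustering_upTo_oneTwelfth h0 h Λ η (isLipschitzCylinder_loopTerm (N := 2) 1 w₁)
    (isLipschitzCylinder_loopTerm (N := 2) 1 w₂)
  refine key.trans ?_
  have hc₁ : ((walkEdges w₁).card : ℝ) ≤ w₁.length := by exact_mod_cast card_walkEdges_le_length w₁
  have hc₂ : ((walkEdges w₂).card : ℝ) ≤ w₂.length := by exact_mod_cast card_walkEdges_le_length w₂
  have h2 : Real.sqrt ((2 : ℕ) : ℝ) * Real.sqrt ((2 : ℕ) : ℝ) = 2 := Real.mul_self_sqrt (by norm_num)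
  set E := exp (-Real.log 2 * setDistEdges (walkEdges w₁) (walkEdges w₂))
  simp only [abs_one, one_mul]
  calc 32 * ((walkEdges w₁).card : ℝ) * ((walkEdges w₂).card : ℝ) *
        (Real.sqrt ((2 : ℕ) : ℝ) * (w₁.length : ℝ) * (Real.sqrt ((2 : ℕ) : ℝ) * (w₂.length : ℝ))) * E
      = 32 * (Real.sqrt ((2 : ℕ) : ℝ) * Real.sqrt ((2 : ℕ) : ℝ)) *
          (((walkEdges w₁).card : ℝ) * w₁.length) * (((walkEdges w₂).card : ℝ) * w₂.length) * E := by ring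
    _ ≤ 32 * (Real.sqrt ((2 : ℕ) : ℝ) * Real.sqrt ((2 : ℕ) : ℝ)) *
          ((w₁.length : ℝ) * w₁.length) * ((w₂.length : ℝ) * w₂.length) * E := by gcongr
    _ = 64 * (w₁.length : ℝ) ^ 2 * (w₂.length : ℝ) ^ 2 * E := by rw [h2]; ring

/-! ### Every `N ≥ 2`: the Bakry–Émery pair, hypothesis-free -/

/-- **ALL `N ≥ 2`, EVERY `d ≥ 1`, HYPOTHESIS-FREE — finite-volume clustering uniformly on the tier-1 ball from the
Bakry–Émery one-link pair** (`oneLinkPoincareSUN_bakryEmery`, `oneLinkVarianceBound_bakryEmery`; `b = 2(d−1)|β| < 1/2`):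
`6(d−1)|β| e^{ε₀}/(1/2 − b) + e^{ε₀/2} ε₁/√(N(1/2 − b)) ≤ ρ < 1` ⇒ for every member of `MemBallZd ε₀ ε₁ R`, every finite
link volume, every boundary field and Lipschitz cylinders `F₁, F₂`:
`|cov_{γ^W_Λ(·|η)}(F₁, F₂)| ≤ 2(2√N)² #Λ₁ #Λ₂ K₁K₂ e^{κ} e^{−(κ/max(1,R)) d(Λ₁,Λ₂)}`, `κ = −log max(ρ,½)`. [folklore] -/
theorem suN_kernel_covariance_decay_bakryEmery (hd : 1 ≤ d) (hN : 2 ≤ N) {β ε₀ ε₁ ρ R : ℝ}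
    (hb : |β| * (2 * ((d : ℝ) - 1)) < 1 / 2)
    (hρ : 6 * ((d : ℝ) - 1) * |β| * exp ε₀ / (1 / 2 - |β| * (2 * ((d : ℝ) - 1))) +
      exp (ε₀ / 2) * ε₁ / Real.sqrt ((N : ℝ) * (1 / 2 - |β| * (2 * ((d : ℝ) - 1)))) ≤ ρ) (hρ1 : ρ < 1)
    {W : Potential (ZdEdge d) (Matrix.specialUnitaryGroup (Fin N) ℂ)}
    {supp : Finset (ZdEdge d) → Finset (Finset (ZdEdge d))} (hmem : MemBallZd ε₀ ε₁ R W supp)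
    (Λ : Finset (ZdEdge d)) (η : LGConfig d (Matrix.specialUnitaryGroup (Fin N) ℂ))
    {F₁ F₂ : LGConfig d (Matrix.specialUnitaryGroup (Fin N) ℂ) → ℝ} {Λ₁ Λ₂ : Finset (ZdEdge d)} {K₁ K₂ : ℝ≥0}
    (hF₁ : IsLipschitzCylinder (fundamentalRep (Fin N)) F₁ Λ₁ K₁)
    (hF₂ : IsLipschitzCylinder (fundamentalRep (Fin N)) F₂ Λ₂ K₂) :
    |cov[F₁, F₂; perturbedYM (d := d) (fundamentalRep (Fin N)) (N * β) W supp Λ η]| ≤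
      2 * (2 * Real.sqrt N) ^ 2 * Λ₁.card * Λ₂.card * ((K₁ : ℝ) * K₂) *
        (exp (-Real.log (max ρ (1 / 2))) * exp (-(-Real.log (max ρ (1 / 2)) / max 1 R) * setDistEdges Λ₁ Λ₂)) := by
  set b : ℝ := |β| * (2 * ((d : ℝ) - 1)) with hbdef
  have hNpos : (0 : ℝ) < N := by exact_mod_cast (show 0 < N by omega)
  have hgap : 0 < 1 / 2 - b := by linarith
  have hP := oneLinkPoincareSUN_bakryEmery hN hb
  have hV := oneLinkVarianceBound_bakryEmery hN hb
  have hc : (0 : ℝ) ≤ 1 / ((N : ℝ) * (1 / 2 - b)) := by positivity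
  have hv : (0 : ℝ) ≤ (N : ℝ) / (1 / 2 - b) := by positivity
  refine kernel_covariance_decay_of_pair hd (by omega) hc hv le_rfl (fun B hB => hP B hB)
    (fun B hB => hV B hB) ?_ hρ1 hmem Λ η hF₁ hF₂
  have hsq1 : Real.sqrt (1 / ((N : ℝ) * (1 / 2 - b)) * ((N : ℝ) / (1 / 2 - b))) = 1 / (1 / 2 - b) := by
    rw [show 1 / ((N : ℝ) * (1 / 2 - b)) * ((N : ℝ) / (1 / 2 - b)) = (1 / (1 / 2 - b)) ^ 2 by field_simp,
      Real.sqrt_sq (by positivity)]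
  have hsq2 : Real.sqrt (1 / ((N : ℝ) * (1 / 2 - b))) = 1 / Real.sqrt ((N : ℝ) * (1 / 2 - b)) := by
    rw [Real.sqrt_div' _ (mul_nonneg hNpos.le hgap.le), Real.sqrt_one]
  rw [hsq1, hsq2]
  calc 6 * ((d : ℝ) - 1) * |β| * (exp ε₀ * (1 / (1 / 2 - b))) + exp (ε₀ / 2) * (1 / Real.sqrt ((N : ℝ) * (1 / 2 - b))) * ε₁
      = 6 * ((d : ℝ) - 1) * |β| * exp ε₀ / (1 / 2 - b) + exp (ε₀ / 2) * ε₁ / Real.sqrt ((N : ℝ) * (1 / 2 - b)) := by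
        ring
    _ ≤ ρ := hρ

end Summit.Ventures.YMGap.RobustBall
end
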